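import Summits.QuantumFields.BalabanUV.Beta.CombHId2CopySum

/-!
# `BalabanUV.Beta.CombHId2W2Letters` — binder row D1 (OWNER an2), (J-a) dictionary, (C2) at ORDER 2, part TWO-c (letters): **THE CHAIN-RULE VERTICES THROUGH
# THE PERIOD COPIES OF A LOCALISED KERNEL SUM TO THE VERTICES THROUGH ITS PERIODISATION** — `Σ'_n vertexOfK (shiftK (M∘n) V) N S b = vertexOfK (dper M V) N S b`,
# `Σ'_n vertexOfM (shiftK (M∘n) V) N Mt b = vertexOfM (dper M V) N Mt b`, hence `Σ'_n dM (shiftK (M∘n) V) N S Mt b = dM (dper M V) N S Mt b` (pointwise)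

WHY.  The operator's second response table `W2OfK K N S M S₂ M₂ b b′ = vertex2OfK K N S₂ b b′ + mixOfK K N M₂ b b′ + mixOfK K N M₂ b′ b + dM (K2OfK K N S M b′) N S M b`
(`SecondOrderResponse` :352) carries, in its last word, the first-order tables read through the columns of the DERIVATIVE OF THE INVERSE at the second bond;
under the door's copy sum in `b′` that kernel runs over its fine-period shifts (C3c `K2OfK_translate_per`), and the shifted columns sum to the columns of
`dper M (K2OfK … b′)` — these letters.  (The sequel periodises `vertex2OfK` ∕ `mixOfK` and assembles `W2SymOfK`.)
WHAT ([folklore]; 0 `def`, 0 cited fact, 0 `def … : Prop`, 0 sorry): §1 `prodBound_colH_shiftK`, **`tsum_vertexOfK_shiftK`**; §2 `exp_l1_sub_nsmul_le` ∕ `summable_exp_l1_sub_nsmul`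
(a coarse-site weight is summable: `e^{−a|x − N•w|₁} ≤ e^{a|x|₁}·e^{−a|w|₁}`), `prodBound_colM_shiftK`, **`tsum_vertexOfM_shiftK`**, **`tsum_dM_shiftK`**; §3 scalar bricks
(`exp_rate_mono`, `exp_half_triangle` — the half-triangle trick behind every product majorant of the sequel —, `abs_le_row_of_biLoc`, `abs_le_of_decays`, `summable_exp_l1_nsmul_sub`).
NOT HERE: `vertex2OfK` ∕ `mixOfK` ∕ `W2SymOfK` periodised, the door's `hId₂`; nothing of Bałaban's asserted; NOT D1, NEVER «G-an2-4 closed», NOT BetaPertH,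
NOT continuum, NOT Clay.

HONEST DEPENDENCY (page 1, mandatory): continuum YM on T⁴ ⇐ BetaPertH ∧ nine spine estimates (0/9 proved); BetaPertH ⇐ (D1) ∧ (D4) ∧ CAP+tail;
G-an2-4 gates asym, D1 and NE2/3/4.  HONEST FRAMING (cell contract, verbatim): «discharging `BetaPertH` makes Bałaban's UV stability UNCONDITIONAL —
a real constructive-QFT result; it is NOT the continuum limit and NOT the Clay problem.»  ABSOLUTE RULE (cell charter, verbatim): «No internally-minted
statement may enter as a cited fact. Every hypothesis is either kernel-proved in this package or a verbatim quotation of a PUBLISHED theorem with page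
reference. The manuscript(s) under audit are NOT citable for their own disputed steps — they are the thing under adjudication; programme-internal
(2001/route/tribunal) claims are never citable.»  Row D1 OWNER an2 (b2b-balaban-beta-an2) gen 44, 2026-08-23; over C3c and `KernelWard`'s Fubini bricks BY NAME.
-/

noncomputable section

open scoped BigOperators

namespace Summit.QuantumFields.BalabanUV.Beta.CombHId2W2Letters

open Literature.MathematicalPhysics.QuantumFieldTheory.Balaban1983to89
open Literature.MathematicalPhysics.QuantumFieldTheory.Balaban1983to89.Beta
open B12Sec2to5 (l1 l1_nonneg)
open B4TorusKernel.MultiPeriod (translate translate_apply)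
open ExpKernelCalculus (MKer Decays BiLoc VertexFamily comp shiftK summable_exp_shift summable_exp_shift' l1_sub_triangle l1_sub_symm)
open AffineAveraging (Site)
open OneStepResolventKernel (Fib)
open OneStepKernelFamily (vertexOfK)
open SecondOrderResponse (colM vertexOfM dM dM_apply)
open InterLevelTransport (cwsum cwsum_apply)
open KernelWard (ProdBound tsum_comm_of_prodBound)
open BalabanStepJetsSucc (l1_sub_le_l1_smul_sub)
open Summit.QuantumFields.BalabanUV.Beta.FP.KernelPeriodisationFibLoc (dper dper_apply shiftK_eq_translate summable_exp_l1_translate)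
open Summit.QuantumFields.BalabanUV.Beta.CombHId1Letters (vertexOfK_apply)

variable {d : ℕ} (M : Fin (d + 1) → ℕ) [∀ μ, NeZero (M μ)] {N : ℕ} [NeZero N]

/-! ## §1 The field-column vertex through the period copies -/

section VertexK

variable {V : MKer (d + 1) (Fib d)} {q q' : Site (d + 1)} {CV δV CS δS : ℝ} {S : Fin (d + 1) → Site (d + 1) → MKer (d + 1) (Fib d)}

omit [NeZero N] in
/-- [folklore] the `(n, u)` family behind `Σ'_n vertexOfK (shiftK (M∘n) V) N S` has a product majorant (the column leg of `V` carries `n`, the table carries `u`). -/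
theorem prodBound_colH_shiftK (hV : BiLoc V q q' CV δV) (hδV : 0 < δV) (hS : ∀ κ u, BiLoc (S κ u) u u CS δS) (hδS : 0 < δS)
    (μ κ : Fin (d + 1)) (y x z : Site (d + 1)) (a c : Fib d) :
    ProdBound fun n u => V (translate M u n) (translate M ((N : ℤ) • y) n) (Sum.inl κ) (Sum.inr μ) * S κ u x z a c := by
  have hCV : 0 ≤ CV := hV.nonneg (Sum.inl 0)
  have hCS : 0 ≤ CS := (hS 0 0).nonneg (Sum.inl 0)
  refine ⟨fun n => Real.exp (-δV * l1 (translate M ((N : ℤ) • y) n - q')), fun u => CV * CS * Real.exp (-δS * l1 (x - u)),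
    (summable_exp_l1_translate M hδV q' ((N : ℤ) • y)).1, (summable_exp_shift hδS x).mul_left _, fun n => (Real.exp_pos _).le,
    fun u => by positivity, fun n u => ?_⟩
  rw [abs_mul]
  have h1 : |V (translate M u n) (translate M ((N : ℤ) • y) n) (Sum.inl κ) (Sum.inr μ)| ≤ CV * Real.exp (-δV * l1 (translate M ((N : ℤ) • y) n - q')) := by
    refine (hV _ _ _ _).trans ?_
    rw [mul_add, Real.exp_add]
    have e1 : Real.exp (-δV * l1 (translate M u n - q)) ≤ 1 := by
      rw [Real.exp_le_one_iff]; exact mul_nonpos_of_nonpos_of_nonneg (neg_nonpos.2 hδV.le) (l1_nonneg _)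
    calc CV * (Real.exp (-δV * l1 (translate M u n - q)) * Real.exp (-δV * l1 (translate M ((N : ℤ) • y) n - q')))
        ≤ CV * (1 * Real.exp (-δV * l1 (translate M ((N : ℤ) • y) n - q'))) :=
          mul_le_mul_of_nonneg_left (mul_le_mul_of_nonneg_right e1 (Real.exp_pos _).le) hCV
      _ = _ := by rw [one_mul]
  have h2 : |S κ u x z a c| ≤ CS * Real.exp (-δS * l1 (x - u)) := by
    refine (hS κ u x z a c).trans ?_
    rw [mul_add, Real.exp_add]
    have e1 : Real.exp (-δS * l1 (z - u)) ≤ 1 := by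
      rw [Real.exp_le_one_iff]; exact mul_nonpos_of_nonpos_of_nonneg (neg_nonpos.2 hδS.le) (l1_nonneg _)
    calc CS * (Real.exp (-δS * l1 (x - u)) * Real.exp (-δS * l1 (z - u))) ≤ CS * (Real.exp (-δS * l1 (x - u)) * 1) :=
          mul_le_mul_of_nonneg_left (mul_le_mul_of_nonneg_left e1 (Real.exp_pos _).le) hCS
      _ = _ := by rw [mul_one]
  calc |V (translate M u n) (translate M ((N : ℤ) • y) n) (Sum.inl κ) (Sum.inr μ)| * |S κ u x z a c|
      ≤ (CV * Real.exp (-δV * l1 (translate M ((N : ℤ) • y) n - q'))) * (CS * Real.exp (-δS * l1 (x - u))) :=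
        mul_le_mul h1 h2 (abs_nonneg _) (by positivity)
    _ = Real.exp (-δV * l1 (translate M ((N : ℤ) • y) n - q')) * (CV * CS * Real.exp (-δS * l1 (x - u))) := by ring

omit [NeZero N] in
/-- [folklore] **THE FIELD-COLUMN VERTICES THROUGH THE PERIOD COPIES OF `V` SUM TO THE VERTEX THROUGH `dper M V`** (pointwise):
`Σ'_n vertexOfK (shiftK (M∘n) V) N S μ y x z a c = vertexOfK (dper M V) N S μ y x z a c` — the column of the `n`-th copy at `(u, N•y)` is
`V (u + M∘n) (N•y + M∘n)`, and `Σ'_n` of these IS the column of `dper M V` (exchange with `Σ'_u` by the product majorant). -/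
theorem tsum_vertexOfK_shiftK (hV : BiLoc V q q' CV δV) (hδV : 0 < δV) (hS : ∀ κ u, BiLoc (S κ u) u u CS δS) (hδS : 0 < δS)
    (μ : Fin (d + 1)) (y x z : Site (d + 1)) (a c : Fib d) :
    ∑' n : Site (d + 1), vertexOfK (shiftK (fun i => (M i : ℤ) * n i) V) N S μ y x z a c = vertexOfK (dper M V) N S μ y x z a c := by
  have hPB := fun κ => prodBound_colH_shiftK M (N := N) hV hδV hS hδS μ κ y x z a c
  simp only [vertexOfK_apply, shiftK_eq_translate, dper_apply]
  rw [Summable.tsum_finsetSum (fun κ _ => ?_)]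
  · refine Finset.sum_congr rfl fun κ _ => ?_
    rw [tsum_comm_of_prodBound (hPB κ)]
    refine tsum_congr fun u => ?_
    rw [tsum_mul_right]
  · obtain ⟨h0, -, -⟩ := (hPB κ).summable
    exact h0.prod

end VertexK

/-! ## §2 The multiplier-column vertex through the period copies -/

section VertexM

variable {V : MKer (d + 1) (Fib d)} {q q' : Site (d + 1)} {CV δV CM δM : ℝ} {Mt : Fin (d + 1) → Site (d + 1) → MKer (d + 1) (Fib d)}

omit [∀ μ, NeZero (M μ)] [NeZero N] in
/-- [folklore] a coarse-site weight is summable: `e^{−a|x − N•w|₁} ≤ e^{a|x|₁}·e^{−a|w|₁}` for `N ≥ 1`, `a ≥ 0`. -/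
theorem exp_l1_sub_nsmul_le (hN : 1 ≤ N) {a : ℝ} (ha : 0 ≤ a) (x w : Site (d + 1)) :
    Real.exp (-a * l1 (x - (N : ℤ) • w)) ≤ Real.exp (a * l1 (x - 0)) * Real.exp (-a * l1 (w - 0)) := by
  rw [← Real.exp_add, Real.exp_le_exp]
  have h1 : l1 (w - 0) ≤ l1 ((N : ℤ) • w - (N : ℤ) • (0 : Site (d + 1))) := l1_sub_le_l1_smul_sub hN w 0
  rw [smul_zero] at h1
  have h2 : l1 ((N : ℤ) • w - 0) ≤ l1 ((N : ℤ) • w - x) + l1 (x - 0) := l1_sub_triangle _ _ _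
  rw [l1_sub_symm ((N : ℤ) • w) x] at h2
  nlinarith [l1_nonneg (x - (N : ℤ) • w), l1_nonneg (x - 0)]

omit [∀ μ, NeZero (M μ)] [NeZero N] in
/-- [folklore] `Σ_w e^{−a|x − N•w|₁}` converges (`N ≥ 1`, `a > 0`). -/
theorem summable_exp_l1_sub_nsmul (hN : 1 ≤ N) {a : ℝ} (ha : 0 < a) (x : Site (d + 1)) :
    Summable fun w : Site (d + 1) => Real.exp (-a * l1 (x - (N : ℤ) • w)) :=
  Summable.of_nonneg_of_le (fun _ => (Real.exp_pos _).le) (fun w => exp_l1_sub_nsmul_le hN ha.le x w)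
    ((summable_exp_shift' ha 0).mul_left _)

/-- [folklore] the `(n, w)` family behind `Σ'_n vertexOfM (shiftK (M∘n) V) N Mt` has a product majorant. -/
theorem prodBound_colM_shiftK (hV : BiLoc V q q' CV δV) (hδV : 0 < δV) (hMt : VertexFamily Mt N CM δM) (hδM : 0 < δM)
    (μ ρ : Fin (d + 1)) (y x z : Site (d + 1)) (a c : Fib d) :
    ProdBound fun n w => V (translate M ((N : ℤ) • w) n) (translate M ((N : ℤ) • y) n) (Sum.inr ρ) (Sum.inr μ) * Mt ρ w x z a c := by
  have hCV : 0 ≤ CV := hV.nonneg (Sum.inl 0)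
  have hCM : 0 ≤ CM := (hMt 0 0).nonneg (Sum.inl 0)
  have hN : 1 ≤ N := Nat.one_le_iff_ne_zero.mpr (NeZero.ne N)
  refine ⟨fun n => Real.exp (-δV * l1 (translate M ((N : ℤ) • y) n - q')), fun w => CV * CM * Real.exp (-δM * l1 (x - (N : ℤ) • w)),
    (summable_exp_l1_translate M hδV q' ((N : ℤ) • y)).1, (summable_exp_l1_sub_nsmul hN hδM x).mul_left _, fun n => (Real.exp_pos _).le,
    fun w => by positivity, fun n w => ?_⟩
  rw [abs_mul]
  have h1 : |V (translate M ((N : ℤ) • w) n) (translate M ((N : ℤ) • y) n) (Sum.inr ρ) (Sum.inr μ)|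
      ≤ CV * Real.exp (-δV * l1 (translate M ((N : ℤ) • y) n - q')) := by
    refine (hV _ _ _ _).trans ?_
    rw [mul_add, Real.exp_add]
    have e1 : Real.exp (-δV * l1 (translate M ((N : ℤ) • w) n - q)) ≤ 1 := by
      rw [Real.exp_le_one_iff]; exact mul_nonpos_of_nonpos_of_nonneg (neg_nonpos.2 hδV.le) (l1_nonneg _)
    calc CV * (Real.exp (-δV * l1 (translate M ((N : ℤ) • w) n - q)) * Real.exp (-δV * l1 (translate M ((N : ℤ) • y) n - q')))
        ≤ CV * (1 * Real.exp (-δV * l1 (translate M ((N : ℤ) • y) n - q'))) :=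
          mul_le_mul_of_nonneg_left (mul_le_mul_of_nonneg_right e1 (Real.exp_pos _).le) hCV
      _ = _ := by rw [one_mul]
  have h2 : |Mt ρ w x z a c| ≤ CM * Real.exp (-δM * l1 (x - (N : ℤ) • w)) := by
    refine (hMt ρ w x z a c).trans ?_
    rw [mul_add, Real.exp_add]
    have e1 : Real.exp (-δM * l1 (z - (N : ℤ) • w)) ≤ 1 := by
      rw [Real.exp_le_one_iff]; exact mul_nonpos_of_nonpos_of_nonneg (neg_nonpos.2 hδM.le) (l1_nonneg _)
    calc CM * (Real.exp (-δM * l1 (x - (N : ℤ) • w)) * Real.exp (-δM * l1 (z - (N : ℤ) • w)))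
        ≤ CM * (Real.exp (-δM * l1 (x - (N : ℤ) • w)) * 1) := mul_le_mul_of_nonneg_left (mul_le_mul_of_nonneg_left e1 (Real.exp_pos _).le) hCM
      _ = _ := by rw [mul_one]
  calc |V (translate M ((N : ℤ) • w) n) (translate M ((N : ℤ) • y) n) (Sum.inr ρ) (Sum.inr μ)| * |Mt ρ w x z a c|
      ≤ (CV * Real.exp (-δV * l1 (translate M ((N : ℤ) • y) n - q'))) * (CM * Real.exp (-δM * l1 (x - (N : ℤ) • w))) :=
        mul_le_mul h1 h2 (abs_nonneg _) (by positivity)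
    _ = Real.exp (-δV * l1 (translate M ((N : ℤ) • y) n - q')) * (CV * CM * Real.exp (-δM * l1 (x - (N : ℤ) • w))) := by ring

/-- [folklore] **THE MULTIPLIER-COLUMN VERTICES THROUGH THE PERIOD COPIES OF `V` SUM TO THE VERTEX THROUGH `dper M V`** (pointwise):
`Σ'_n vertexOfM (shiftK (M∘n) V) N Mt μ y x z a c = vertexOfM (dper M V) N Mt μ y x z a c`. -/
theorem tsum_vertexOfM_shiftK (hV : BiLoc V q q' CV δV) (hδV : 0 < δV) (hMt : VertexFamily Mt N CM δM) (hδM : 0 < δM)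
    (μ : Fin (d + 1)) (y x z : Site (d + 1)) (a c : Fib d) :
    ∑' n : Site (d + 1), vertexOfM (shiftK (fun i => (M i : ℤ) * n i) V) N Mt μ y x z a c = vertexOfM (dper M V) N Mt μ y x z a c := by
  have hPB := fun ρ => prodBound_colM_shiftK M (N := N) hV hδV hMt hδM μ ρ y x z a c
  have e : ∀ (K : MKer (d + 1) (Fib d)), vertexOfM K N Mt μ y x z a c = ∑ ρ, ∑' w, K ((N : ℤ) • w) ((N : ℤ) • y) (Sum.inr ρ) (Sum.inr μ) * Mt ρ w x z a c :=
    fun K => by simp only [vertexOfM, cwsum_apply, colM]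
  simp only [e, shiftK_eq_translate, dper_apply]
  rw [Summable.tsum_finsetSum (fun ρ _ => ?_)]
  · refine Finset.sum_congr rfl fun ρ _ => ?_
    rw [tsum_comm_of_prodBound (hPB ρ)]
    refine tsum_congr fun w => ?_
    rw [tsum_mul_right]
  · obtain ⟨h0, -, -⟩ := (hPB ρ).summable
    exact h0.prod

/-- [folklore] **`dM` THROUGH THE PERIOD COPIES SUMS TO `dM` THROUGH THE PERIODISATION** (pointwise):
`Σ'_n dM (shiftK (M∘n) V) N S Mt μ y x z a c = dM (dper M V) N S Mt μ y x z a c`. -/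
theorem tsum_dM_shiftK {CS δS : ℝ} {S : Fin (d + 1) → Site (d + 1) → MKer (d + 1) (Fib d)} (hV : BiLoc V q q' CV δV) (hδV : 0 < δV)
    (hS : ∀ κ u, BiLoc (S κ u) u u CS δS) (hδS : 0 < δS) (hMt : VertexFamily Mt N CM δM) (hδM : 0 < δM)
    (μ : Fin (d + 1)) (y x z : Site (d + 1)) (a c : Fib d) :
    ∑' n : Site (d + 1), dM (shiftK (fun i => (M i : ℤ) * n i) V) N S Mt μ y x z a c = dM (dper M V) N S Mt μ y x z a c := by
  have s1 : Summable fun n : Site (d + 1) => vertexOfK (shiftK (fun i => (M i : ℤ) * n i) V) N S μ y x z a c := by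
    have h := fun κ => prodBound_colH_shiftK M (N := N) hV hδV hS hδS μ κ y x z a c
    have hs : ∀ κ : Fin (d + 1), Summable fun n => ∑' u, V (translate M u n) (translate M ((N : ℤ) • y) n) (Sum.inl κ) (Sum.inr μ) * S κ u x z a c :=
      fun κ => by obtain ⟨h0, -, -⟩ := (h κ).summable; exact h0.prod
    refine (summable_sum (s := Finset.univ) fun κ _ => hs κ).congr fun n => ?_
    simp only [vertexOfK_apply, shiftK_eq_translate]
  have s2 : Summable fun n : Site (d + 1) => vertexOfM (shiftK (fun i => (M i : ℤ) * n i) V) N Mt μ y x z a c := by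
    have h := fun ρ => prodBound_colM_shiftK M (N := N) hV hδV hMt hδM μ ρ y x z a c
    have hs : ∀ ρ : Fin (d + 1), Summable fun n =>
        ∑' w, V (translate M ((N : ℤ) • w) n) (translate M ((N : ℤ) • y) n) (Sum.inr ρ) (Sum.inr μ) * Mt ρ w x z a c :=
      fun ρ => by obtain ⟨h0, -, -⟩ := (h ρ).summable; exact h0.prod
    refine (summable_sum (s := Finset.univ) fun ρ _ => hs ρ).congr fun n => ?_
    simp only [vertexOfM, cwsum_apply, colM, shiftK_eq_translate]
  simp only [dM_apply]
  rw [s1.tsum_add s2, tsum_vertexOfK_shiftK M hV hδV hS hδS, tsum_vertexOfM_shiftK M hV hδV hMt hδM]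

end VertexM

/-! ## §3 Scalar bricks for the product majorants -/

section Bricks

omit [∀ μ, NeZero (M μ)] [NeZero N]

/-- [folklore] weakening the rate of a decay factor: `e^{−δ·L} ≤ e^{−r·L}` for `r ≤ δ`, `L ≥ 0`. -/
theorem exp_rate_mono {δ r L : ℝ} (hr : r ≤ δ) (hL : 0 ≤ L) : Real.exp (-δ * L) ≤ Real.exp (-r * L) :=
  Real.exp_le_exp.2 (by nlinarith)

/-- [folklore] **THE HALF-TRIANGLE TRICK**: `e^{−r|u−p|₁}·e^{−r|X−u|₁} ≤ e^{−(r∕2)|X−p|₁}·e^{−(r∕2)|u−p|₁}` (`r ≥ 0`) — trade half of the middle point's decay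
for decay of the end point, keeping a summable factor in the middle point. -/
theorem exp_half_triangle {r : ℝ} (hr : 0 ≤ r) (X u p : Site (d + 1)) :
    Real.exp (-r * l1 (u - p)) * Real.exp (-r * l1 (X - u)) ≤ Real.exp (-(r / 2) * l1 (X - p)) * Real.exp (-(r / 2) * l1 (u - p)) := by
  rw [← Real.exp_add, ← Real.exp_add, Real.exp_le_exp]
  have ht : l1 (X - p) ≤ l1 (X - u) + l1 (u - p) := l1_sub_triangle X u p
  nlinarith [l1_nonneg (X - u), l1_nonneg (u - p), l1_nonneg (X - p)]

/-- [folklore] a bi-localised kernel bounded by its ROW leg at a weaker rate: `|S x z a c| ≤ C·e^{−r|x−u|₁}` for `r ≤ δ`. -/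
theorem abs_le_row_of_biLoc {S : MKer (d + 1) (Fib d)} {u u' : Site (d + 1)} {C δ r : ℝ} (hS : BiLoc S u u' C δ) (hr : r ≤ δ) (hr0 : 0 ≤ r)
    (x z : Site (d + 1)) (a c : Fib d) : |S x z a c| ≤ C * Real.exp (-r * l1 (x - u)) := by
  have hC : 0 ≤ C := hS.nonneg (Sum.inl 0)
  refine (hS x z a c).trans (mul_le_mul_of_nonneg_left ?_ hC)
  have h1 : Real.exp (-δ * (l1 (x - u) + l1 (z - u'))) ≤ Real.exp (-δ * l1 (x - u)) :=
    Real.exp_le_exp.2 (by nlinarith [l1_nonneg (z - u'), l1_nonneg (x - u), hr0.trans hr])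
  exact h1.trans (exp_rate_mono hr (l1_nonneg _))

/-- [folklore] a decaying kernel's entry bounded at a weaker rate. -/
theorem abs_le_of_decays {K : MKer (d + 1) (Fib d)} {C δ r : ℝ} (hK : Decays K C δ) (hr : r ≤ δ) (x z : Site (d + 1)) (a c : Fib d) :
    |K x z a c| ≤ C * Real.exp (-r * l1 (x - z)) :=
  (hK x z a c).trans (mul_le_mul_of_nonneg_left (exp_rate_mono hr (l1_nonneg _)) (hK.nonneg (Sum.inl 0)))

/-- [folklore] `Σ_w e^{−a|N•w − p|₁}` converges (`N ≥ 1`, `a > 0`): `|N•w − p|₁ ≥ |w|₁ − |p|₁`. -/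
theorem summable_exp_l1_nsmul_sub (hN : 1 ≤ N) {a : ℝ} (ha : 0 < a) (p : Site (d + 1)) :
    Summable fun w : Site (d + 1) => Real.exp (-a * l1 ((N : ℤ) • w - p)) := by
  refine (summable_exp_l1_sub_nsmul (N := N) hN ha p).congr fun w => ?_
  rw [l1_sub_symm]

end Bricks

end Summit.QuantumFields.BalabanUV.Beta.CombHId2W2Letters

end
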